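import Summits.Ventures.WeilGRH.TwistedGramCoeffCReal
import Summits.RiemannHypothesis.RiemannHypothesis.Theorems.WeilFormatCColumnKernel
import HarnessLib

/-!
# GRH arm (rh-explicit, venture WeilGRH): twisted format C for a COMPLEX character — L-C3b on `ℤ` at every order:
  the column structure of the real kernel `Re twistedGramCoeffC χ a` and its order-`J` families

Cell `rh-explicit`, WEIL TRACK — GRH ARM (lit/typing seat weil-grh-5 gen11).  Sequel of `TwistedGramCoeffCReal.lean`
(`G = twistedGramCoeffC χ a` is real symmetric with `G(p,m) = (−1)^{p+m}(F^χ_m − F^χ_p)/(π(m − p))`, `p ≠ m`).  Expanding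
the Cauchy factor GEOMETRICALLY in `1/m` (both signs of `m`; ζ's sector files expand `1/(m² − i²)` instead):

* `inv_sub_eq_geom_add`, `abs_inv_sub_sub_geom_le` — `1/(m − p) = Σ_{j<J} p^j/m^{j+1} + (p/m)^J/(m − p)` and
  `|1/(m − p) − Σ_{j<J} p^j/m^{j+1}| ≤ 2|p|^J/|m|^{J+1}` for `2|p| ≤ |m|`, `m ≠ 0`;
* `abs_complexModeF_le`, `abs_complexModeF_le_far` — the complex-twisted mode function
  `F^χ_n = ½Im ψ(¼ + iω_n/2) + Σ_k Λ_k k^{-1/2}(Re χ(k) sin(ω_n log k) + Im χ(k) cos(ω_n log k)) − T_n` obeys, for ALL `n ∈ ℤ`,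
  `|F^χ_n| ≤ C_F = π/4 + ΛΣ + a(1+E)/π`, and `|F^χ_m| ≤ C_A = π/4 + ΛΣ + a(1+E)/(πB₃)` for `|m| ≥ B₃ ≥ 1`
  (`|Re χ sin + Im χ cos| ≤ |χ(k)| ≤ 1`; `Y_{−n} = −Y_n`, `T_{−n} = −T_n`);
* `abs_re_twistedGramCoeffC_col_sub_families_le` — **order-`J` column decomposition on `ℤ`**: for `m ≠ 0`, `2|p| ≤ |m|`,
  `|G(p,m) − (−1)^m[(F^χ_m/π)·Σ_{j<J} v^A_j(p)/m^{j+1} + Σ_{j<J} v^B_j(p)/m^{j+1}]| ≤ (4C_F|p|^J/π)/|m|^{J+1}` with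
  `v^A_j(p) = (−1)^p p^j`, `v^B_j(p) = (−1)^p(−p^j F^χ_p/π)` — `2J` families, the SAME for `m → +∞` and `m → −∞`.

This is the analytic input of the complex-character L-C3b (hypothesis `hU` of
`weilPositivityOnChar_of_twistedC_formatC_certificates_re`): what remains is weil-10's Hankel bookkeeping
(`WeilFormatC.sum_Ico_sq_sum_div_pow_le` with exponents `j+1`, once per sign of `m`).  No definitions; no named facts;
RH/GRH-free; standard axioms.
-/

set_option autoImplicit false

noncomputable section

open Complex Finset
open scoped Real BigOperators ComplexConjugate ArithmeticFunction.vonMangoldt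

namespace Summit.Ventures.WeilGRH

open Literature.NumberTheory.LFunctions
open Literature.NumberTheory.LFunctions.Yoshida1992 (freq archExpSumSin)
open Literature.Analysis.SpecialFunctions
open Summit.RiemannHypothesis.RiemannHypothesis.Theorems.WeilFormatC

variable {q : ℕ} {a : ℝ}

/-! ## The geometric expansion of the Cauchy factor -/

section Geom

/-- `1/(m − p) = Σ_{j<J} p^j/m^{j+1} + (p/m)^J/(m − p)` (`m ≠ 0`, `p ≠ m`). -/
theorem inv_sub_eq_geom_add {m p : ℝ} (hm : m ≠ 0) (hpm : p ≠ m) (J : ℕ) :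
    1 / (m - p) = (∑ j ∈ Finset.range J, p ^ j / m ^ (j + 1)) + (p / m) ^ J / (m - p) := by
  have hr : p / m ≠ 1 := fun h ↦ hpm (by rwa [div_eq_one_iff_eq hm] at h)
  have hsum : ∑ j ∈ Finset.range J, p ^ j / m ^ (j + 1) = (1 / m) * ∑ j ∈ Finset.range J, (p / m) ^ j := by
    rw [Finset.mul_sum]
    refine Finset.sum_congr rfl fun j _ ↦ ?_
    rw [div_pow, pow_succ]
    field_simp
  rw [hsum, geom_sum_eq hr]
  have hmp : m - p ≠ 0 := sub_ne_zero.mpr (Ne.symm hpm)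
  have hr' : p / m - 1 ≠ 0 := sub_ne_zero.mpr hr
  rw [div_pow]
  field_simp
  ring

/-- **`|1/(m − p) − Σ_{j<J} p^j/m^{j+1}| ≤ 2|p|^J/|m|^{J+1}`** for `2|p| ≤ |m|`, `m ≠ 0`. -/
theorem abs_inv_sub_sub_geom_le {m p : ℝ} (hm : m ≠ 0) (hpm : 2 * |p| ≤ |m|) (J : ℕ) :
    |1 / (m - p) - ∑ j ∈ Finset.range J, p ^ j / m ^ (j + 1)| ≤ 2 * |p| ^ J / |m| ^ (J + 1) := by
  have hm0 : 0 < |m| := abs_pos.mpr hm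
  have hpm' : p ≠ m := fun h ↦ by rw [h] at hpm; linarith
  have hgap : |m| / 2 ≤ |m - p| := by
    have := abs_sub_abs_le_abs_sub m p
    linarith
  rw [inv_sub_eq_geom_add hm hpm' J, add_sub_cancel_left, abs_div, div_pow, abs_div, abs_pow, abs_pow]
  rw [div_div, div_le_div_iff₀ (by positivity) (by positivity), pow_succ]
  have h1 : |p| ^ J * (|m| ^ J * |m|) ≤ |p| ^ J * (|m| ^ J * (2 * |m - p|)) := by
    refine mul_le_mul_of_nonneg_left (mul_le_mul_of_nonneg_left (by linarith) (by positivity)) (by positivity)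
  linarith [h1]

end Geom

/-! ## The complex-twisted mode function -/

section ModeF

/-- `|Re χ(k) sin θ + Im χ(k) cos θ| ≤ 1` (Cauchy–Schwarz and `|χ(k)| ≤ 1`). -/
theorem abs_re_mul_sin_add_im_mul_cos_le (χ : DirichletCharacter ℂ q) (k : ℕ) (θ : ℝ) :
    |(χ (k : ZMod q)).re * Real.sin θ + (χ (k : ZMod q)).im * Real.cos θ| ≤ 1 := by
  have hn : ‖χ (k : ZMod q)‖ ^ 2 ≤ 1 := by
    have h := DirichletCharacter.norm_le_one χ (k : ZMod q)
    have h0 := norm_nonneg (χ (k : ZMod q))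
    nlinarith
  rw [Complex.sq_norm, Complex.normSq_apply] at hn
  have hsc := Real.sin_sq_add_cos_sq θ
  rw [← sq_le_one_iff_abs_le_one]
  nlinarith [sq_nonneg ((χ (k : ZMod q)).re * Real.cos θ - (χ (k : ZMod q)).im * Real.sin θ)]

/-- The twisted prime mode sum is bounded by `ΛΣ`. -/
theorem abs_complexPrimeMode_le (χ : DirichletCharacter ℂ q) (a : ℝ) (n : ℤ) :
    |∑ k ∈ weilPrimeIndex a, (Λ k : ℝ) / Real.sqrt k *
        ((χ (k : ZMod q)).re * Real.sin (freq a n * Real.log k) + (χ (k : ZMod q)).im * Real.cos (freq a n * Real.log k))|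
      ≤ ∑ k ∈ weilPrimeIndex a, (Λ k : ℝ) / Real.sqrt k := by
  refine (Finset.abs_sum_le_sum_abs _ _).trans (Finset.sum_le_sum fun k _ ↦ ?_)
  have hw : 0 ≤ (Λ k : ℝ) / Real.sqrt k := div_nonneg ArithmeticFunction.vonMangoldt_nonneg (Real.sqrt_nonneg _)
  rw [abs_mul, abs_of_nonneg hw]
  exact (mul_le_mul_of_nonneg_left (abs_re_mul_sin_add_im_mul_cos_le χ k _) hw).trans (le_of_eq (mul_one _))

/-- The archimedean parts at a nonzero integer mode: `|Y_n| ≤ π/2 + 2a/(π|n|)` and `|T_n| ≤ E a/(π|n|)`. -/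
theorem abs_arch_parts_le (ha : 0 < a) {n : ℤ} (hn : n ≠ 0) :
    |(Complex.digamma (1 / 4 + ((freq a n : ℝ) : ℂ) / 2 * I)).im| ≤ π / 2 + 2 * a / (π * n.natAbs)
      ∧ |archExpSumSin a n| ≤ weilArchDensity (2 * a) * a / (π * n.natAbs) := by
  have hk : 1 ≤ n.natAbs := Int.natAbs_pos.mpr hn
  have hY := abs_im_digamma_freq_sub_le ha hk
  have hT0 := archExpSumSin_nonneg ha hk
  have hT := archExpSumSin_le ha hk
  rcases Int.natAbs_eq n with h | h
  · rw [← h] at hY hT0 hT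
    refine ⟨?_, ?_⟩
    · have := abs_sub_abs_le_abs_sub ((Complex.digamma (1 / 4 + ((freq a n : ℝ) : ℂ) / 2 * I)).im) (π / 2)
      rw [abs_of_pos (by positivity : (0 : ℝ) < π / 2)] at this
      linarith
    · rw [abs_of_nonneg hT0]; exact hT
  · have eY : (Complex.digamma (1 / 4 + ((freq a n : ℝ) : ℂ) / 2 * I)).im
        = -(Complex.digamma (1 / 4 + ((freq a (n.natAbs : ℤ) : ℝ) : ℂ) / 2 * I)).im := by
      conv_lhs => rw [h, freq_neg]
      exact im_digamma_quarter_neg _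
    have eT : archExpSumSin a n = -archExpSumSin a (n.natAbs : ℤ) := by
      conv_lhs => rw [h, archExpSumSin_neg]
    rw [eY, eT, abs_neg, abs_neg]
    refine ⟨?_, ?_⟩
    · have := abs_sub_abs_le_abs_sub ((Complex.digamma (1 / 4 + ((freq a (n.natAbs : ℤ) : ℝ) : ℂ) / 2 * I)).im) (π / 2)
      rw [abs_of_pos (by positivity : (0 : ℝ) < π / 2)] at this
      linarith
    · rw [abs_of_nonneg hT0]; exact hT

/-- **`|F^χ_n| ≤ C_F`** for every `n ∈ ℤ`: `|½Y_n + P^χ_n − T_n| ≤ π/4 + ΛΣ + a(1+E)/π`. -/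
theorem abs_complexModeF_le (χ : DirichletCharacter ℂ q) (ha : 0 < a) (n : ℤ) :
    |(Complex.digamma (1 / 4 + ((freq a n : ℝ) : ℂ) / 2 * I)).im / 2
        + (∑ k ∈ weilPrimeIndex a, (Λ k : ℝ) / Real.sqrt k *
            ((χ (k : ZMod q)).re * Real.sin (freq a n * Real.log k) + (χ (k : ZMod q)).im * Real.cos (freq a n * Real.log k)))
        - archExpSumSin a n|
      ≤ π / 4 + (∑ k ∈ weilPrimeIndex a, (Λ k : ℝ) / Real.sqrt k) + a * (1 + weilArchDensity (2 * a)) / π := by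
  have hE0 : 0 < weilArchDensity (2 * a) := weilArchDensity_pos (by positivity)
  have hP := abs_complexPrimeMode_le χ a n
  have hL : 0 ≤ ∑ k ∈ weilPrimeIndex a, (Λ k : ℝ) / Real.sqrt k :=
    Finset.sum_nonneg fun k _ ↦ div_nonneg ArithmeticFunction.vonMangoldt_nonneg (Real.sqrt_nonneg _)
  rcases eq_or_ne n 0 with h0 | hn
  · subst h0
    rw [im_digamma_quarter_zero, archExpSumSin_zero]
    simp only [zero_div, zero_add, sub_zero]
    refine hP.trans ?_
    have : 0 ≤ a * (1 + weilArchDensity (2 * a)) / π := by positivity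
    linarith [Real.pi_pos]
  obtain ⟨hY, hT⟩ := abs_arch_parts_le ha hn
  have hk : 1 ≤ n.natAbs := Int.natAbs_pos.mpr hn
  have hk' : (1 : ℝ) ≤ n.natAbs := by exact_mod_cast hk
  have h1 : 2 * a / (π * n.natAbs) ≤ 2 * a / π := by
    apply div_le_div_of_nonneg_left (by positivity) (by positivity)
    nlinarith [Real.pi_pos]
  have h2 : weilArchDensity (2 * a) * a / (π * n.natAbs) ≤ weilArchDensity (2 * a) * a / π := by
    apply div_le_div_of_nonneg_left (by positivity) (by positivity)
    nlinarith [Real.pi_pos]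
  have hsplit : a * (1 + weilArchDensity (2 * a)) / π = (2 * a / π) / 2 + weilArchDensity (2 * a) * a / π := by ring
  rw [hsplit]
  generalize (Complex.digamma (1 / 4 + ((freq a n : ℝ) : ℂ) / 2 * I)).im = Y at hY ⊢
  generalize (∑ k ∈ weilPrimeIndex a, (Λ k : ℝ) / Real.sqrt k *
    ((χ (k : ZMod q)).re * Real.sin (freq a n * Real.log k) + (χ (k : ZMod q)).im * Real.cos (freq a n * Real.log k))) = P
    at hP ⊢
  generalize archExpSumSin a n = T at hT ⊢
  rw [abs_le] at hY hP hT ⊢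
  constructor
  · linarith [hY.1, hP.1, hT.2]
  · linarith [hY.2, hP.2, hT.1]

/-- **`|F^χ_m| ≤ C_A`** on the tail `|m| ≥ B₃ ≥ 1`: `|½Y_m + P^χ_m − T_m| ≤ π/4 + ΛΣ + a(1+E)/(πB₃)`. -/
theorem abs_complexModeF_le_far (χ : DirichletCharacter ℂ q) (ha : 0 < a) {B₃ : ℕ} (hB₃ : 1 ≤ B₃) {m : ℤ}
    (hm : B₃ ≤ m.natAbs) :
    |(Complex.digamma (1 / 4 + ((freq a m : ℝ) : ℂ) / 2 * I)).im / 2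
        + (∑ k ∈ weilPrimeIndex a, (Λ k : ℝ) / Real.sqrt k *
            ((χ (k : ZMod q)).re * Real.sin (freq a m * Real.log k) + (χ (k : ZMod q)).im * Real.cos (freq a m * Real.log k)))
        - archExpSumSin a m|
      ≤ π / 4 + (∑ k ∈ weilPrimeIndex a, (Λ k : ℝ) / Real.sqrt k)
        + a * (1 + weilArchDensity (2 * a)) / (π * B₃) := by
  have hE0 : 0 < weilArchDensity (2 * a) := weilArchDensity_pos (by positivity)
  have hP := abs_complexPrimeMode_le χ a m
  have hn : m ≠ 0 := fun h ↦ by rw [h] at hm; simp at hm; omega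
  obtain ⟨hY, hT⟩ := abs_arch_parts_le ha hn
  have hB0 : (0 : ℝ) < B₃ := by exact_mod_cast hB₃
  have hBm : (B₃ : ℝ) ≤ m.natAbs := by exact_mod_cast hm
  have h1 : 2 * a / (π * m.natAbs) ≤ 2 * a / (π * B₃) := by
    apply div_le_div_of_nonneg_left (by positivity) (by positivity)
    nlinarith [Real.pi_pos]
  have h2 : weilArchDensity (2 * a) * a / (π * m.natAbs) ≤ weilArchDensity (2 * a) * a / (π * B₃) := by
    apply div_le_div_of_nonneg_left (by positivity) (by positivity)
    nlinarith [Real.pi_pos]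
  have hsplit : a * (1 + weilArchDensity (2 * a)) / (π * B₃)
      = (2 * a / (π * B₃)) / 2 + weilArchDensity (2 * a) * a / (π * B₃) := by ring
  rw [hsplit]
  generalize (Complex.digamma (1 / 4 + ((freq a m : ℝ) : ℂ) / 2 * I)).im = Y at hY ⊢
  generalize (∑ k ∈ weilPrimeIndex a, (Λ k : ℝ) / Real.sqrt k *
    ((χ (k : ZMod q)).re * Real.sin (freq a m * Real.log k) + (χ (k : ZMod q)).im * Real.cos (freq a m * Real.log k))) = P
    at hP ⊢
  generalize archExpSumSin a m = T at hT ⊢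
  rw [abs_le] at hY hP hT ⊢
  constructor
  · linarith [hY.1, hP.1, hT.2]
  · linarith [hY.2, hP.2, hT.1]

end ModeF

/-! ## The order-`J` column decomposition on `ℤ` -/

section Decomp

/-- **Order-`J` column decomposition of the complex-character kernel on `ℤ`.**  For `a > 0`, `m ≠ 0`, `2|p| ≤ |m|` and
every `J`: `|Re G^χ(p,m) − (−1)^m[(F^χ_m/π)Σ_{j<J}(−1)^p p^j/m^{j+1} + Σ_{j<J}(−1)^p(−p^j F^χ_p/π)/m^{j+1}]| ≤ (4C_F|p|^J/π)/|m|^{J+1}`. -/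
theorem abs_re_twistedGramCoeffC_col_sub_families_le (χ : DirichletCharacter ℂ q) (ha : 0 < a) {p m : ℤ}
    (hm : m ≠ 0) (hpm : 2 * p.natAbs ≤ m.natAbs) (J : ℕ) :
    |(twistedGramCoeffC χ a p m).re
      - (-1 : ℝ) ^ m *
        (((Complex.digamma (1 / 4 + ((freq a m : ℝ) : ℂ) / 2 * I)).im / 2
            + (∑ k ∈ weilPrimeIndex a, (Λ k : ℝ) / Real.sqrt k *
                ((χ (k : ZMod q)).re * Real.sin (freq a m * Real.log k)
                  + (χ (k : ZMod q)).im * Real.cos (freq a m * Real.log k)))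
            - archExpSumSin a m) / π
            * ∑ j ∈ Finset.range J, ((-1 : ℝ) ^ p * (p : ℝ) ^ j) / (m : ℝ) ^ (j + 1)
          + ∑ j ∈ Finset.range J, ((-1 : ℝ) ^ p *
              (-((p : ℝ) ^ j) * ((Complex.digamma (1 / 4 + ((freq a p : ℝ) : ℂ) / 2 * I)).im / 2
                  + (∑ k ∈ weilPrimeIndex a, (Λ k : ℝ) / Real.sqrt k *
                      ((χ (k : ZMod q)).re * Real.sin (freq a p * Real.log k)
                        + (χ (k : ZMod q)).im * Real.cos (freq a p * Real.log k)))
                  - archExpSumSin a p) / π)) / (m : ℝ) ^ (j + 1))|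
      ≤ (4 * (π / 4 + (∑ k ∈ weilPrimeIndex a, (Λ k : ℝ) / Real.sqrt k) + a * (1 + weilArchDensity (2 * a)) / π)
            * (p.natAbs : ℝ) ^ J / π) / (m.natAbs : ℝ) ^ (J + 1) := by
  have hpm' : p ≠ m := fun h ↦ by rw [h] at hpm; have := Int.natAbs_pos.mpr hm; omega
  have hm0 : (m : ℝ) ≠ 0 := by exact_mod_cast hm
  have hFm := abs_complexModeF_le χ ha m
  have hFp := abs_complexModeF_le χ ha p
  rw [re_twistedGramCoeffC_offDiag χ a hpm']
  generalize (Complex.digamma (1 / 4 + ((freq a m : ℝ) : ℂ) / 2 * I)).im / 2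
      + (∑ k ∈ weilPrimeIndex a, (Λ k : ℝ) / Real.sqrt k *
          ((χ (k : ZMod q)).re * Real.sin (freq a m * Real.log k) + (χ (k : ZMod q)).im * Real.cos (freq a m * Real.log k)))
      - archExpSumSin a m = Fm at hFm ⊢
  generalize (Complex.digamma (1 / 4 + ((freq a p : ℝ) : ℂ) / 2 * I)).im / 2
      + (∑ k ∈ weilPrimeIndex a, (Λ k : ℝ) / Real.sqrt k *
          ((χ (k : ZMod q)).re * Real.sin (freq a p * Real.log k) + (χ (k : ZMod q)).im * Real.cos (freq a p * Real.log k)))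
      - archExpSumSin a p = Fp at hFp ⊢
  generalize (π / 4 + (∑ k ∈ weilPrimeIndex a, (Λ k : ℝ) / Real.sqrt k) + a * (1 + weilArchDensity (2 * a)) / π) = CF
    at hFm hFp ⊢
  -- the structured part is `(−1)^{p+m}(Fm − Fp)/π · Σ_j p^j/m^{j+1}`
  have hsign : (-1 : ℝ) ^ (p + m) = (-1) ^ p * (-1) ^ m := zpow_add₀ (by norm_num) p m
  set S := ∑ j ∈ Finset.range J, (p : ℝ) ^ j / (m : ℝ) ^ (j + 1) with hS
  have h4 : ∑ j ∈ Finset.range J, ((-1 : ℝ) ^ p * (p : ℝ) ^ j) / (m : ℝ) ^ (j + 1) = (-1 : ℝ) ^ p * S := by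
    rw [hS, Finset.mul_sum]
    refine Finset.sum_congr rfl fun j _ ↦ by ring
  have h3 : ∑ j ∈ Finset.range J, ((-1 : ℝ) ^ p * (-((p : ℝ) ^ j) * Fp / π)) / (m : ℝ) ^ (j + 1)
      = (-1 : ℝ) ^ p * (-(Fp / π) * S) := by
    rw [hS, Finset.mul_sum, Finset.mul_sum]
    refine Finset.sum_congr rfl fun j _ ↦ by ring
  have e : (-1 : ℝ) ^ (p + m) * (Fm - Fp) / (π * ((m : ℝ) - p))
        - (-1 : ℝ) ^ m * (Fm / π * ∑ j ∈ Finset.range J, ((-1 : ℝ) ^ p * (p : ℝ) ^ j) / (m : ℝ) ^ (j + 1)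
          + ∑ j ∈ Finset.range J, ((-1 : ℝ) ^ p * (-((p : ℝ) ^ j) * Fp / π)) / (m : ℝ) ^ (j + 1))
      = (-1 : ℝ) ^ (p + m) * ((Fm - Fp) / π) * (1 / ((m : ℝ) - p) - S) := by
    rw [h4, h3, hsign]
    field_simp
    ring
  rw [e, abs_mul, abs_mul]
  have habs1 : |(-1 : ℝ) ^ (p + m)| = 1 := by
    rw [abs_zpow, abs_neg, abs_one, one_zpow]
  rw [habs1, one_mul]
  have hpmR : 2 * |(p : ℝ)| ≤ |(m : ℝ)| := by
    rw [← Int.cast_abs, ← Int.cast_abs, Int.abs_eq_natAbs, Int.abs_eq_natAbs]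
    exact_mod_cast hpm
  have hX := abs_inv_sub_sub_geom_le hm0 hpmR J
  rw [← hS] at hX
  have hF : |(Fm - Fp) / π| ≤ 2 * CF / π := by
    rw [abs_div, abs_of_pos Real.pi_pos]
    refine div_le_div_of_nonneg_right ?_ Real.pi_pos.le
    calc |Fm - Fp| ≤ |Fm| + |Fp| := abs_sub _ _
      _ ≤ CF + CF := add_le_add hFm hFp
      _ = 2 * CF := by ring
  have hCF : 0 ≤ CF := (abs_nonneg _).trans hFm
  have habsp : |(p : ℝ)| = (p.natAbs : ℝ) := by
    rw [← Int.cast_abs, Int.abs_eq_natAbs, Int.cast_natCast]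
  have habsm : |(m : ℝ)| = (m.natAbs : ℝ) := by
    rw [← Int.cast_abs, Int.abs_eq_natAbs, Int.cast_natCast]
  rw [habsp, habsm] at hX
  calc |(Fm - Fp) / π| * |1 / ((m : ℝ) - p) - S|
      ≤ (2 * CF / π) * (2 * (p.natAbs : ℝ) ^ J / (m.natAbs : ℝ) ^ (J + 1)) :=
        mul_le_mul hF hX (abs_nonneg _) (by positivity)
    _ = _ := by ring

end Decomp

end Summit.Ventures.WeilGRH

end
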